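import Mathlib
import HarnessLib
import Summits.HubbardSuperconductivity.HubbardSuperconductivity.Theorems.KLProgrammeKLRegimeEngineTowerDoorToKitLip
import Summits.HubbardSuperconductivity.HubbardSuperconductivity.Theorems.KLProgrammeKLRegimeEngineTowerDoorToKitFO

/-!
# Route `KLProgramme` — crux K3 ENGINE (stmt-HubbardSuperconductivity-20437), stub (e) proof-input «(e)-D-ROWS», (M3)/(M4): DOOR → KIT DICTIONARY for the
# two new Grassmann right sides of the two-volume Lipschitz tower — the ZONE bracket and the ENTRY-COST first order (seat hubbard-kl-k3c4-p1 g22; `--supports` 20437)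

The two-volume (Lipschitz) tower closes by E1's `towerBornDiff_le_law₄` (T3-Lip₄), whose block-step hypothesis and source row are fed, in E1's dictionary
(`…EngineTowerDoorToKit`: `N := N₀ − 1`, `ψ := ρ⁻²`, `Φ := eα/κ²`, `τ := (e²(κ+ρ))²`, `σ := κ²`, degree-`0` sizes `0`, `D ≥ |Γ|/2`), by Grassmann doors.  Two
doors of the «(e)-D-ROWS» source list are NEW (DROWS-SCOPE-g22 §7), and this file is their dictionary entry — the twins of k3c5-p2's
`…EngineTowerDoorToKitLip.doorGradedLip_le_kitStepLip` and of E1's `…EngineTowerDoorToKitFO.doorBinomial_le_towerFO`: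

* **`doorGradedZone_le_kitStepLip`** — the ZONE bracket's right side (`Literature/…/GrassmannEffectiveActionGradedZoneLipschitzDB`: the telescoped mixed graded
  sum over `Ico 2 N₀` + `Λ·2·`tail in `normV μ̄`) `≤` T2-Lip's step right side with **`Ct := 2Λ`** (`Σ_{n∈Icc 2 (N₀−1)} eΦ^{n−1}ψ^p·towerSLip D τ ν̄ μ̄ n p +
  2Λ·ψ^p e·towerV·(Φ·towerV)^{N₀−1}/(1−Φ·towerV)`), for `1 ≤ Λ` (`Λ = 1 + Λ_J·ρ_k`): the consumer `…TwoVolumeLipZoneLaw.zoneSrc_le_chernoff` takes exactly this;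
* **`doorEntryBinomial_le_foSrc`** — the ENTRY-COST first order's right side (`Literature/…/GrassmannGaussConvEntryGram…_even`: `(p+1)(2p+1)·s·Σ_{p+1 ≤ m'}
  C(2m',2p+2) κ^{2m'−2p−2} N(m')`) `≤ (p+1)(2p+1)·s·[N(p+1) + towerFO D κ² N (p+1)]`: the consumer `…TwoVolumeLipSourceLaw.foSrc_le` takes exactly this
  (`σₑ := s`, `σₙ := κ²`, units slot-wise by E1's `…TowerKitUnits`).

Pure real analysis; nothing about the model is asserted; nothing asserts the (D) rows, stub (e), VL, K3 or superconductivity.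
References: Benfatto–Giuliani–Mastropietro 2006 §2.8, (2.86)–(2.90) [cite: BenfattoGiulianiMastropietro2006]; Gawȩdzki–Kupiainen 1985 §3.
-/

noncomputable section

namespace Summit.HubbardSuperconductivity.HubbardSuperconductivity.Theorems.TwoVolumeDefect

set_option linter.dupNamespace false -- summit = problem name (single-conjunct summit), D-0017

open Real Finset Literature.MathematicalPhysics.QuantumLattice
open Summit.HubbardSuperconductivity.HubbardSuperconductivity.Theorems.EngineV8

/-! ## §1 The zone bracket's right side in kit form (`Ct := 2Λ`) -/

/-- **THE ZONE DOOR'S BRACKET IS DOMINATED BY T2-Lip's STEP RIGHT SIDE WITH `Ct := 2Λ`.**  Data as in `doorGradedLip_le_kitStepLip` (`κ, ρ > 0`, `α ≥ 0`,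
majorant `μ̄ ≥ 0` and difference profile `ν̄ ≥ 0` with degree-`0` size `0`, `D ≥ |Γ|/2`, `N₀ ≥ 2`, `m + 1 = 2p`, guard `(eα/κ²)·towerV D τ μ̄ < 1`) and `1 ≤ Λ`:
`[zone door mixed graded sum over Ico 2 N₀] + Λ·2·[door tail in normV μ̄] ≤ Σ_{n∈Icc 2 (N₀−1)} e·Φ^{n−1}·ψ^p·towerSLip D τ ν̄ μ̄ n p + (2Λ)·(ψ^p·e·towerV·(Φ·towerV)^{N₀−1}/(1−Φ·towerV))`,
`Φ = eα/κ²`, `ψ = ρ⁻²`, `τ = (e²(κ+ρ))²`. -/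
theorem doorGradedZone_le_kitStepLip {Γ : Type*} [Fintype Γ] {κ ρ α Λ : ℝ} (hκ : 0 < κ) (hρ : 0 < ρ) (hα : 0 ≤ α) (hΛ : 1 ≤ Λ)
    {Nμ Nν : ℕ → ℝ} (hNμ0 : ∀ m, 0 ≤ Nμ m) (hNμ00 : Nμ 0 = 0) (hNν0 : ∀ m, 0 ≤ Nν m) (hNν00 : Nν 0 = 0)
    {D : ℕ} (hD : Fintype.card Γ / 2 ≤ D) {N₀ : ℕ} (hN₀ : 2 ≤ N₀) {m p : ℕ} (hmp : m + 1 = 2 * p)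
    (hguard : exp 1 * α / κ ^ 2 * towerV D ((exp 2 * (κ + ρ)) ^ 2) Nμ < 1) :
    (∑ n ∈ Ico 2 N₀, (ρ⁻¹ ^ (m + 1) * κ⁻¹ ^ (2 * (n - 1)) * (α ^ (n - 1) * exp n)) *
        ∑ δ ∈ (Fintype.piFinset fun _ : Fin n => range (Fintype.card Γ / 2 + 1)) with m + 1 + 2 * (n - 1) ≤ ∑ a, 2 * δ a,
          ∑ a, (exp 2 * (κ + ρ)) ^ (2 * δ a) * Nν (δ a) * ∏ b ∈ univ.erase a, (exp 2 * (κ + ρ)) ^ (2 * δ b) * Nμ (δ b)) +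
      Λ * (2 * (ρ⁻¹ ^ (m + 1) * (exp 1 * normV Γ κ ρ Nμ) * (exp 1 * α * normV Γ κ ρ Nμ / κ ^ 2) ^ (N₀ - 1) /
        (1 - exp 1 * α * normV Γ κ ρ Nμ / κ ^ 2))) ≤
    ∑ n ∈ Icc 2 (N₀ - 1), exp 1 * (exp 1 * α / κ ^ 2) ^ (n - 1) * (ρ⁻¹ ^ 2) ^ p *
        towerSLip D ((exp 2 * (κ + ρ)) ^ 2) Nν Nμ n p +
      (2 * Λ) * ((ρ⁻¹ ^ 2) ^ p * exp 1 * towerV D ((exp 2 * (κ + ρ)) ^ 2) Nμ *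
        (exp 1 * α / κ ^ 2 * towerV D ((exp 2 * (κ + ρ)) ^ 2) Nμ) ^ (N₀ - 1) /
        (1 - exp 1 * α / κ ^ 2 * towerV D ((exp 2 * (κ + ρ)) ^ 2) Nμ)) := by
  set τ := (exp 2 * (κ + ρ)) ^ 2 with hτ
  set Φ := exp 1 * α / κ ^ 2 with hΦ
  have hΦ0 : 0 ≤ Φ := by rw [hΦ]; positivity
  -- the zone-free dictionary (graded part + `2·`tail)
  have hbase := doorGradedLip_le_kitStepLip (Γ := Γ) hκ hρ hα hNμ0 hNμ00 hNν0 hNν00 hD hN₀ hmp hguard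
  -- the tail alone: `normV ≤ towerV`, monotone tail
  have hV := normV_le_towerV hκ.le hρ.le hNμ0 hNμ00 hD (κ := κ) (ρ := ρ)
  have hV0 : 0 ≤ normV Γ κ ρ Nμ := normV_nonneg hκ.le hρ.le hNμ0
  have hψ : 0 ≤ (ρ⁻¹ ^ 2) ^ p := by positivity
  have htail := geomTail_mono hΦ0 hV0 hV hguard (N₀ - 1)
  have hlhs : ρ⁻¹ ^ (m + 1) * (exp 1 * normV Γ κ ρ Nμ) * (exp 1 * α * normV Γ κ ρ Nμ / κ ^ 2) ^ (N₀ - 1) /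
        (1 - exp 1 * α * normV Γ κ ρ Nμ / κ ^ 2) =
      (ρ⁻¹ ^ 2) ^ p * (exp 1 * normV Γ κ ρ Nμ * (Φ * normV Γ κ ρ Nμ) ^ (N₀ - 1) / (1 - Φ * normV Γ κ ρ Nμ)) := by
    rw [hmp, pow_mul, hΦ]
    have : exp 1 * α * normV Γ κ ρ Nμ / κ ^ 2 = exp 1 * α / κ ^ 2 * normV Γ κ ρ Nμ := by ring
    rw [this]; ring
  have hrhs : (ρ⁻¹ ^ 2) ^ p * exp 1 * towerV D τ Nμ * (Φ * towerV D τ Nμ) ^ (N₀ - 1) / (1 - Φ * towerV D τ Nμ) =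
      (ρ⁻¹ ^ 2) ^ p * (exp 1 * towerV D τ Nμ * (Φ * towerV D τ Nμ) ^ (N₀ - 1) / (1 - Φ * towerV D τ Nμ)) := by ring
  have hT : ρ⁻¹ ^ (m + 1) * (exp 1 * normV Γ κ ρ Nμ) * (exp 1 * α * normV Γ κ ρ Nμ / κ ^ 2) ^ (N₀ - 1) /
        (1 - exp 1 * α * normV Γ κ ρ Nμ / κ ^ 2) ≤
      (ρ⁻¹ ^ 2) ^ p * exp 1 * towerV D τ Nμ * (Φ * towerV D τ Nμ) ^ (N₀ - 1) / (1 - Φ * towerV D τ Nμ) := by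
    rw [hlhs, hrhs]
    exact mul_le_mul_of_nonneg_left htail hψ
  -- `Λ ≥ 1`: the extra `(Λ − 1)·2·tail` is monotone too
  have hΛ1 : 0 ≤ Λ - 1 := sub_nonneg.2 hΛ
  have hextra := mul_le_mul_of_nonneg_left hT (mul_nonneg hΛ1 zero_le_two)
  linarith [hbase, hextra]

/-! ## §2 The entry-cost first order's right side in kit form -/

/-- **THE ENTRY-COST DOOR'S RIGHT SIDE IS DOMINATED BY `(p+1)(2p+1)·s·[N(p+1) + towerFO D κ² N (p+1)]`** (the shape consumed by
`…TwoVolumeLipSourceLaw.foSrc_le` with `σₑ := s`, `σₙ := κ²`): for `κ, s ≥ 0`, `N ≥ 0`, `D_Γ ≤ D`,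
`(p+1)(2p+1)·s·Σ_{m′ < D_Γ+1} (if p+1 ≤ m′ then C(2m′, 2p+2)·κ^{2m′−(2p+2)}·N m′ else 0) ≤ (p+1)(2p+1)·s·(N (p+1) + towerFO D (κ²) N (p+1))`
— the `m′ = p+1` term is the single explicit contraction (`C(2p+2,2p+2)·κ⁰ = 1`), the others are E1's `doorBinomial_le_towerFO` at `p+1`. -/
theorem doorEntryBinomial_le_foSrc {κ s : ℝ} (hκ : 0 ≤ κ) (hs : 0 ≤ s) {N : ℕ → ℝ} (hN0 : ∀ m, 0 ≤ N m) {DΓ D : ℕ} (hD : DΓ ≤ D) (p : ℕ) :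
    (((p + 1) * (2 * p + 1) : ℕ) : ℝ) * s *
        ∑ m' ∈ range (DΓ + 1), (if p + 1 ≤ m' then ((2 * m').choose (2 * p + 2) : ℝ) * κ ^ (2 * m' - (2 * p + 2)) * N m' else 0) ≤
      (((p + 1) * (2 * p + 1) : ℕ) : ℝ) * s * (N (p + 1) + towerFO D (κ ^ 2) N (p + 1)) := by
  refine mul_le_mul_of_nonneg_left ?_ (by positivity)
  -- split the summand at `m′ = p+1`
  have hsplit : ∀ m' : ℕ, (if p + 1 ≤ m' then ((2 * m').choose (2 * p + 2) : ℝ) * κ ^ (2 * m' - (2 * p + 2)) * N m' else 0) =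
      (if p + 1 = m' then N m' else 0) +
        (if p + 1 < m' then ((2 * m').choose (2 * (p + 1)) : ℝ) * κ ^ (2 * m' - 2 * (p + 1)) * N m' else 0) := by
    intro m'
    have h2 : 2 * p + 2 = 2 * (p + 1) := by ring
    by_cases hle : p + 1 ≤ m'
    · rcases eq_or_lt_of_le hle with heq | hlt
      · subst heq
        rw [if_pos le_rfl, if_pos rfl, if_neg (lt_irrefl _), add_zero, h2, Nat.choose_self, Nat.sub_self, pow_zero, Nat.cast_one, one_mul,
          one_mul]
      · rw [if_pos hle, if_neg (ne_of_lt hlt), if_pos hlt, zero_add, h2]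
    · rw [if_neg hle, if_neg (fun h => hle (le_of_eq h)), if_neg (fun h => hle (le_of_lt h)), add_zero]
  rw [sum_congr rfl fun m' _ => hsplit m', sum_add_distrib, sum_ite_eq]
  refine add_le_add ?_ (doorBinomial_le_towerFO hκ hN0 hD p)
  split_ifs
  · exact le_rfl
  · exact hN0 _

end Summit.HubbardSuperconductivity.HubbardSuperconductivity.Theorems.TwoVolumeDefect

end
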